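import Summits.CriticalPhenomena.Ising3DConformalLimit.Theses.ArmDressing
import Summits.CriticalPhenomena.Ising3DConformalLimit.Theorems.HyperoctahedralRPLimitRotationInvariant
import Summits.CriticalPhenomena.Ising3DConformalLimit.Theorems.HyperoctahedralRPHRP2Rigidity
import Summits.CriticalPhenomena.Ising3DConformalLimit.Theorems.MoebiusLimitExists.Negative.ScaleRedundant
import Summits.CriticalPhenomena.Ising3DConformalLimit.Theorems.MoebiusLimitExists.Negative.FreeTranslations
import Summits.CriticalPhenomena.Ising3DConformalLimit.Theorems.ArmDressingArmDressingGlueDefs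
import Summits.CriticalPhenomena.Ising3DConformalLimit.Theorems.ArmDressingArmDressingGlueWiredBoxLimit
import Summits.CriticalPhenomena.Ising3DConformalLimit.Theorems.ArmDressingArmDressingGlueArm1Pos
import Summits.CriticalPhenomena.Ising3DConformalLimit.Theorems.ArmDressingArmDressingGlueEdwardsSokal
import Summits.CriticalPhenomena.Ising3DConformalLimit.Theorems.ArmDressingArmDressingGlueDressedLimitExists
import Summits.CriticalPhenomena.Ising3DConformalLimit.Theorems.ArmDressingArmDressingGlueInvCov
import HarnessLib

/-!
# Crux `ArmDressingGlue` (stmt-CriticalPhenomena-15700) CLOSED MODULO the non-degeneracy of the CROSS law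

Sorry-free composition of the landed stubs of the line `registered` (skeleton `Cruxes/ArmDressingGlue/Lines/birth.lean`,
v2): the crux `ArmDressing.ArmDressingGlue = BallConnectivityMoebius → EvenPatternDecoupling → ArmExtensionFactorisation
→ OneArmRenormalisedLimit` FOLLOWS from the single extra hypothesis `CrossLawPositive`
(`Theorems/ArmDressingArmDressingGlueDefs.lean`: for every family of `n + n` non-degenerate generalised balls the
infinite-volume critical FK-Ising probability that inner member `i` is joined to outer member `n + i` for all `i` stays
bounded away from `0` as the mesh `δ → 0⁺` — the 3D stand-in for the RSW lower bounds that Camia–Feng's planar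
bookkeeping uses tacitly, absent from cruxes A/B/C and the support ES as typed):

  `armDressingGlue_of_crossLawPositive : CrossLawPositive → ArmDressing.ArmDressingGlue`.

Ingredients (all theorems of the tree): the support ES from its clauses (`stub_wiredBoxLimit`, `stub_arm1Pos`,
`stub_edwardsSokalIdentity`); dressed existence (`stub_dressedLimitExists`, Camia–Feng Thm 1 transposed);
normalisation off `NonCoincident` and the AUTOMATIC symmetries of any non-degenerate pointwise limit of `criticalCorr 3`
— translations (`isTranslationInvariant_normalised_of_limit`), dilations with `Δ ∈ [1/2, 1]`
(`exists_scaleCovariant_normalised`), rotations (`LimitRotationInvariant_of ∘ HRP2Rigidity_of`, items 1980/1979); and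
dressed inversion covariance from non-degeneracy (`InvBook.stub_dressedInversionCovarianceOfPos`, Camia–Feng §3.2.3
transposed).  The planner can close the crux item by adding `CrossLawPositive` to crux A (or filing it as an item) and
citing this theorem.  Registered bookkeeping stub: `stub_gluedModuloPositivity` (same statement).

Reference: F. Camia, Y. Feng, arXiv:2411.01467 (SPA 2025), Thm 1, §3.2.2–3.2.3.
-/

noncomputable section

namespace Summit.CriticalPhenomena.Ising3DConformalLimit.Cruxes.ArmDressingGlue.InvBook

open scoped Topology Classical
open Filter Set
open Literature.Probability.LatticeModels
open Summit.CriticalPhenomena.Ising3DConformalLimit.Theses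
open Summit.CriticalPhenomena.Ising3DConformalLimit.Cruxes.ArmDressingGlue.Vocab

/-- **The crux modulo non-degeneracy**: `CrossLawPositive → ArmDressing.ArmDressingGlue` — the composition of the
line's landed stubs (ES clauses, dressed existence, automatic translations/dilations/rotations of the normalised limit,
dressed inversion covariance from `CrossLawPositive`), repacked through the definitional reading of the target.
[cite: CamiaFeng2025, Thm 1 and §3.2.2–3.2.3] -/
theorem armDressingGlue_of_crossLawPositive (hPos : CrossLawPositive) : ArmDressing.ArmDressingGlue := by
  intro hA hB hC
  -- (0) the support ES from its three clauses
  have hES : ArmDressing.InfiniteVolumeEdwardsSokal :=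
    infiniteVolumeEdwardsSokal_iff.2 ⟨WiredBoxLimitProof.stub_wiredBoxLimit,
      Arm1PosProof.stub_arm1Pos WiredBoxLimitProof.stub_wiredBoxLimit, EdwardsSokalProof.stub_edwardsSokalIdentity⟩
  -- (1) the renormalisation is admissible: `arm1(δ,1) > 0`, hence `ρ₁ > 0`, on `(0,1]`
  have hpos : ∀ δ ∈ Set.Ioc (0:ℝ) 1, 0 < arm1 δ 1 := hES.2.1
  have hρ : ∀ δ ∈ Set.Ioc (0:ℝ) 1, 0 < rho1 δ := fun δ hδ => inv_pos.2 (hpos δ hδ)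
  -- (2) dressed existence
  obtain ⟨S, hlim, hnd⟩ := DressedLimitProof.stub_dressedLimitExists hB hC hES
  -- (3) normalise off the non-coincident locus; translations and dilations are automatic (tree)
  have hlim' := MoebiusLimitExistsNegative.normalised_hasLimit hlim
  have hnd' := MoebiusLimitExistsNegative.normalised_nondeg hnd
  have htr' := MoebiusLimitExistsNegative.isTranslationInvariant_normalised_of_limit hlim
  have hnorm' : ∀ (n : ℕ) (z : Fin n → EuclideanSpace ℝ (Fin 3)), z ∉ NonCoincident 3 n →
      (fun (n : ℕ) (x : Fin n → EuclideanSpace ℝ (Fin 3)) => if x ∈ NonCoincident 3 n then S n x else 0) n z = 0 :=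
    fun n z hz => if_neg hz
  obtain ⟨Δ, hwin, hsc'⟩ := MoebiusLimitExistsNegative.exists_scaleCovariant_normalised hρ hlim hnd
  -- (4) rotations are automatic (items 1980/1979): reflection positivity + Liouville rigidity
  have hrot' : IsRotationInvariant
      (fun (n : ℕ) (x : Fin n → EuclideanSpace ℝ (Fin 3)) => if x ∈ NonCoincident 3 n then S n x else 0) :=
    Summit.CriticalPhenomena.Ising3DConformalLimit.Cruxes.LimitRotationInvariant.QuarterTurnLiouville.LimitRotationInvariant_of
      Summit.CriticalPhenomena.Ising3DConformalLimit.Cruxes.HRP2Rigidity.XRayMellin.HRP2Rigidity_of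
      rho1 Δ _ hρ hlim' hnorm' hnd' htr' hsc'
  -- (5) inversion covariance with the same `Δ`, from non-degeneracy of the CROSS law
  have hinv' := stub_dressedInversionCovarianceOfPos hPos hA hB hC hES Δ _ hlim' hnorm' hnd' ⟨htr', hrot'⟩ hsc'
  -- (6) repack the target
  exact oneArmRenormalisedLimit_iff.2
    ⟨hpos, Δ, _, by linarith [hwin.1], hlim', hnd', ⟨htr', hrot'⟩, hsc', hinv'⟩

/-- Registered bookkeeping stub `stub_gluedModuloPositivity` (= `armDressingGlue_of_crossLawPositive`).
[cite: CamiaFeng2025, §3.2.2–3.2.3] -/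
theorem stub_gluedModuloPositivity : CrossLawPositive → ArmDressing.ArmDressingGlue :=
  armDressingGlue_of_crossLawPositive

end Summit.CriticalPhenomena.Ising3DConformalLimit.Cruxes.ArmDressingGlue.InvBook

end
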